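import Summits.SmoothPoincare4.SmoothPoincare4.Theorems.CylinderEntropyCylinderRungTwoStaticMonotonicityIdentity
import Summits.SmoothPoincare4.SmoothPoincare4.Theorems.CylinderEntropyCylinderRungTwoGaussianDensityScaleDerivative
import Summits.SmoothPoincare4.SmoothPoincare4.Theorems.CylinderEntropyCylinderRungTwoLocalAreaBoundOfTwoScale
import Summits.SmoothPoincare4.SmoothPoincare4.Theorems.CylinderEntropyCylinderRungTwoProductTestLimitBounds
import Mathlib.Analysis.Calculus.MeanValue
import HarnessLib

/-!
# Route `CylinderEntropy`, crux `CylinderRungTwo` (stmt-SmoothPoincare4-7631), line `killing-flux`: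
# the STATIC GAUSSIAN MONOTONICITY for cross-sections of `N = S⁴ × ℝ ⊂ ℝ⁶` (registered helpers
# `helper_gaussianDensity_deriv_lowerBound`, `helper_staticTwoScaleMonotonicity`; lead c4)

For a closed immersed cross-section `f : M⁴ → N` with smooth unit normal `ν` tangent to `N`, mean
curvature `H` of `(f, ν)` in `ℝ⁶`, `g = f^*δ`, and the Gaussian density at centre `x₀ ∈ ℝ⁶` and scale
`s > 0`,
  `F(s) = ∫_M G_s(f w) dμ_g`,  `G_s(z) = exp(-|z - x₀|²/(4s)) / (4πs)²`,
we PROVE the static (Colding–Minicozzi `F`-functional / Ecker) monotonicity in the curved slice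
`N ⊂ ℝ⁶`:

* `gaussianDensity_deriv_lowerBound` — **`F'(τ) ≥ -¼ ∫ G_τ H² dμ_g - 4 F(τ)`**: by the static
  monotonicity identity (`staticMonotonicity_identity`, Green's identity for `φ = G_τ`) the scale
  derivative `F'(τ) = ∫ G_τ (|r|²/(4τ²) - 2/τ)` (`hasDerivAt_integral_gaussianProfile`) equals
  `∫ G_τ [ (⟨r,n⟩/(2τ) - H_n/2)² + (⟨r,ν⟩/(2τ) - H/2)² - (H_n² + H²)/4 ]`, `r = f(w) - x₀`, `n` the radial
  normal of `N`, `H_n = 4 - |ν'|² ∈ [3, 4]` the radial mean curvature; the ambient curvature term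
  `H_n² ≤ 16` is absorbed by `4F`;
* `staticTwoScaleMonotonicity` — **`e^{4σ} F(σ) ≤ e^{4τ} F(τ) + e^{4τ} (64π²σ)⁻¹ ∫_M H² dμ_g`** for
  `0 < σ ≤ τ`: the function `s ↦ e^{4s} F(s) - e^{4τ} E/(64π² s)`, `E = ∫ H²`, is non-decreasing on
  `[σ, τ]` since `(e^{4s}F)' ≥ -¼ e^{4s} ∫ G_s H² ≥ -e^{4s} E /(64π² s²) ≥ -e^{4τ} E/(64π² s²)`
  (`G_s ≤ (4πs)⁻²`);
* `helper_gaussianDensity_deriv_lowerBound`, `helper_staticTwoScaleMonotonicity` — the registered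
  helpers, verbatim;
* `helper_localAreaBound` — the now UNCONDITIONAL local area bound
  `μ_g(f⁻¹ B(x₀,ρ)) ≤ e^{4R²+1/4} (μ_g(M) ρ⁴/R⁴ + ρ²/4 ∫ H²)` for `0 < ρ ≤ R` and every centre
  (`helper_localAreaBoundOfTwoScale` applied to `helper_staticTwoScaleMonotonicity`): the uniform
  upper density bound at all scales `ρ ≥ (∫H²)^{1/2}` which every compactness theorem for the
  almost-stationary cross-sections of the line (`stub_areaQuantization`) consumes.

Everything here is PROVED (no `sorry`, no new definitions, no named facts).

References: T. H. Colding, W. P. Minicozzi II, *Generic mean curvature flow I*, Ann. of Math. 175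
(2012) 755–833, §3; K. Ecker, *Regularity Theory for Mean Curvature Flow* (2004), Prop. 3.16,
Thm. 3.17; L. Simon, *Lectures on Geometric Measure Theory* (1983), §17.
-/

-- the prescribed namespace `Summit.SmoothPoincare4.SmoothPoincare4.…` repeats `SmoothPoincare4`
set_option linter.dupNamespace false

noncomputable section

open Bundle Set Function Filter MeasureTheory Module
open scoped Manifold ContDiff Topology RealInnerProductSpace BigOperators

namespace Summit.SmoothPoincare4.SmoothPoincare4.Cruxes.CylinderRungTwo.KillingFlux

open Literature.Geometry.Riemannian Literature.Geometry.Riemannian.EuclideanHypersurface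
open Literature.Geometry.Lorentzian Literature.Geometry.Lorentzian.PseudoRiemannianMetric
open Literature.Geometry.Riemannian.SphericalCylinderEntropy (truncL truncL_apply)
open Literature.Geometry.Manifold.CylinderSlice (padL padL_apply_castSucc padL_apply_last)

/-! ## Elementary inequalities -/

section Elementary

/-- **Completing the square under the Gaussian weight.** For `G ≥ 0`, `τ > 0` and `0 ≤ H_n ≤ 4`:
`-¼ G H² - 4 G ≤ G ((a² + b²)/(4τ²) - (H_n a + H b)/(2τ))`, because the right-hand side is
`G [(a/(2τ) - H_n/2)² + (b/(2τ) - H/2)² - H_n²/4 - H²/4]` and `H_n² ≤ 16`. [folklore] -/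
theorem weighted_square_completion_lowerBound (G a b Hn H τ : ℝ) (hG : 0 ≤ G) (hτ : 0 < τ)
    (hHn0 : 0 ≤ Hn) (hHn4 : Hn ≤ 4) :
    -(1 / 4) * (G * H ^ 2) - 4 * G ≤
      G * ((a ^ 2 + b ^ 2) / (4 * τ ^ 2) - (Hn * a + H * b) / (2 * τ)) := by
  have hτ0 : τ ≠ 0 := hτ.ne'
  have key : (a ^ 2 + b ^ 2) / (4 * τ ^ 2) - (Hn * a + H * b) / (2 * τ)
      = (a / (2 * τ) - Hn / 2) ^ 2 + (b / (2 * τ) - H / 2) ^ 2 - Hn ^ 2 / 4 - H ^ 2 / 4 := by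
    field_simp
    ring
  rw [key]
  have h1 : Hn ^ 2 ≤ 16 := by nlinarith
  have h2 : 0 ≤ G * (a / (2 * τ) - Hn / 2) ^ 2 := mul_nonneg hG (sq_nonneg _)
  have h3 : 0 ≤ G * (b / (2 * τ) - H / 2) ^ 2 := mul_nonneg hG (sq_nonneg _)
  have h4 : G * Hn ^ 2 ≤ G * 16 := mul_le_mul_of_nonneg_left h1 hG
  nlinarith

/-- For a unit vector `ν ∈ ℝ⁶`, the horizontal part `S = ∑_{i<5} νᵢ²` satisfies `0 ≤ 4 - S ≤ 4`
(`norm_sq_eq_sum_castSucc_add_sq` of `…ProductTestLimitBounds.lean`). [folklore] -/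
theorem radialMeanCurvature_bounds {v : EuclideanSpace ℝ (Fin 6)} (hv : ‖v‖ = 1) :
    0 ≤ 4 - ∑ i : Fin 5, v (Fin.castSucc i) ^ 2 ∧ 4 - ∑ i : Fin 5, v (Fin.castSucc i) ^ 2 ≤ 4 := by
  have hsplit := norm_sq_eq_sum_castSucc_add_sq v
  rw [hv, one_pow] at hsplit
  have hS0 : 0 ≤ ∑ i : Fin 5, v (Fin.castSucc i) ^ 2 := Finset.sum_nonneg fun i _ => sq_nonneg _
  have h5 : 0 ≤ v 5 ^ 2 := sq_nonneg _
  constructor <;> linarith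

end Elementary

/-! ## The derivative lower bound and the two-scale inequality -/

section Monotonicity

variable {M : Type*} [TopologicalSpace M] [ChartedSpace (EuclideanSpace ℝ (Fin 4)) M]
  [IsManifold (𝓡 4) ∞ M] [CompactSpace M] [T2Space M] [MeasurableSpace M] [BorelSpace M]

omit [IsManifold (𝓡 4) ∞ M] [CompactSpace M] [T2Space M] [MeasurableSpace M] [BorelSpace M] in
/-- A smooth unit normal for the Euclidean metric has norm one pointwise. [folklore] -/
theorem norm_eq_one_of_isUnitNormal {f νf : M → EuclideanSpace ℝ (Fin 6)}
    (hun : (euclideanMetric (EuclideanSpace ℝ (Fin 6))).IsUnitNormal (𝓡 4) f νf 1) (w : M) :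
    ‖νf w‖ = 1 := by
  have h : ⟪νf w, νf w⟫ = (1 : ℝ) := by
    have := hun.val_self w
    rwa [euclideanMetric_apply] at this
  rw [real_inner_self_eq_norm_sq] at h
  nlinarith [norm_nonneg (νf w)]

/-- **The scale derivative of the Gaussian density is bounded below by the weighted Willmore energy**
(static Gaussian monotonicity, differential form): for a closed immersed cross-section `f : M⁴ → N`
with smooth unit normal `ν` tangent to `N`, `τ > 0` and any centre `x₀ ∈ ℝ⁶`,
`-¼ ∫ G_τ H² dμ_g - 4 ∫ G_τ dμ_g ≤ ∫ G_τ (|r|²/(4τ²) - 2/τ) dμ_g = F'(τ)`.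
Proof: subtract the static monotonicity identity (`staticMonotonicity_identity`) from the right-hand
side; the difference has integrand `G_τ ((⟨r,n⟩² + ⟨r,ν⟩²)/(4τ²) - (H_n⟨r,n⟩ + H⟨r,ν⟩)/(2τ))`, which is
bounded below pointwise by `-¼ G_τ H² - 4 G_τ` (`weighted_square_completion_lowerBound`,
`0 ≤ H_n = 4 - |ν'|² ≤ 4`). [cite: ColdingMinicozzi2012, §3] -/
theorem gaussianDensity_deriv_lowerBound {f νf : M → EuclideanSpace ℝ (Fin 6)}
    (hf : (euclideanMetric (EuclideanSpace ℝ (Fin 6))).IsSpacelikeImmersion (𝓡 4) f)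
    (hν : ContMDiff (𝓡 4) 𝓘(ℝ, EuclideanSpace ℝ (Fin 6)) ∞ νf)
    (hun : (euclideanMetric (EuclideanSpace ℝ (Fin 6))).IsUnitNormal (𝓡 4) f νf 1)
    (hN : ∀ x, ∑ i : Fin 5, f x (Fin.castSucc i) ^ 2 = 1)
    (hνN : ∀ x, ∑ i : Fin 5, νf x (Fin.castSucc i) * f x (Fin.castSucc i) = 0)
    (x₀ : EuclideanSpace ℝ (Fin 6)) {τ : ℝ} (hτ : 0 < τ) :
    -(1 / 4) * ∫ w, (Real.exp (-‖f w - x₀‖ ^ 2 / (4 * τ)) / (4 * Real.pi * τ) ^ 2) *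
          (euclideanMetric (EuclideanSpace ℝ (Fin 6))).meanCurvature f contMDiff_pullbackBilin_holds
            hf νf w ^ 2
        ∂riemannianMeasure ((euclideanMetric (EuclideanSpace ℝ (Fin 6))).inducedRiemannianMetric f
          contMDiff_pullbackBilin_holds hf)
      - 4 * ∫ w, Real.exp (-‖f w - x₀‖ ^ 2 / (4 * τ)) / (4 * Real.pi * τ) ^ 2
        ∂riemannianMeasure ((euclideanMetric (EuclideanSpace ℝ (Fin 6))).inducedRiemannianMetric f
          contMDiff_pullbackBilin_holds hf) ≤
      ∫ w, (Real.exp (-‖f w - x₀‖ ^ 2 / (4 * τ)) / (4 * Real.pi * τ) ^ 2) *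
          (‖f w - x₀‖ ^ 2 / (4 * τ ^ 2) - 2 / τ)
        ∂riemannianMeasure ((euclideanMetric (EuclideanSpace ℝ (Fin 6))).inducedRiemannianMetric f
          contMDiff_pullbackBilin_holds hf) := by
  set g₁ := (euclideanMetric (EuclideanSpace ℝ (Fin 6))).inducedRiemannianMetric f
    contMDiff_pullbackBilin_holds hf with hg₁
  set Hm : M → ℝ := fun w => (euclideanMetric (EuclideanSpace ℝ (Fin 6))).meanCurvature f
    contMDiff_pullbackBilin_holds hf νf w with hHm
  set G : M → ℝ := fun w => Real.exp (-‖f w - x₀‖ ^ 2 / (4 * τ)) / (4 * Real.pi * τ) ^ 2 with hG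
  set a : M → ℝ := fun w => ⟪f w - x₀, padL (truncL (f w))⟫ with ha
  set b : M → ℝ := fun w => ⟪f w - x₀, νf w⟫ with hb
  set S : M → ℝ := fun w => ∑ i : Fin 5, νf w (Fin.castSucc i) ^ 2 with hS
  -- the identity
  have hid : ∫ w, G w * ((‖f w - x₀‖ ^ 2 - a w ^ 2 - b w ^ 2) / (4 * τ ^ 2) - 2 / τ
      + ((4 - S w) * a w + Hm w * b w) / (2 * τ)) ∂riemannianMeasure g₁ = 0 :=
    staticMonotonicity_identity hf hν hun hN hνN x₀ hτ
  -- continuity of all the players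
  have hfc : Continuous f := hf.contMDiff_self.continuous
  have hνc : Continuous νf := hν.continuous
  have hGc : Continuous G := continuous_gaussianWeight_comp hf x₀ τ
  have hHc : Continuous Hm := continuous_meanCurvature_euclidean hf hν
  have hac : Continuous a :=
    (hfc.sub continuous_const).inner ((padL.comp truncL).continuous.comp hfc)
  have hbc : Continuous b := (hfc.sub continuous_const).inner hνc
  have hSc : Continuous S := by
    refine continuous_finsetSum _ fun i _ => ?_
    exact ((EuclideanSpace.proj (Fin.castSucc i) :
      EuclideanSpace ℝ (Fin 6) →L[ℝ] ℝ).continuous.comp hνc).pow 2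
  have hrc : Continuous fun w => ‖f w - x₀‖ ^ 2 := (hfc.sub continuous_const).norm.pow 2
  -- the three integrands
  set P : M → ℝ := fun w => G w * (‖f w - x₀‖ ^ 2 / (4 * τ ^ 2) - 2 / τ) with hP
  set Q : M → ℝ := fun w => G w * ((‖f w - x₀‖ ^ 2 - a w ^ 2 - b w ^ 2) / (4 * τ ^ 2) - 2 / τ
      + ((4 - S w) * a w + Hm w * b w) / (2 * τ)) with hQ
  set R : M → ℝ := fun w => G w * ((a w ^ 2 + b w ^ 2) / (4 * τ ^ 2)
      - ((4 - S w) * a w + Hm w * b w) / (2 * τ)) with hR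
  set L : M → ℝ := fun w => -(1 / 4) * (G w * Hm w ^ 2) - 4 * G w with hL
  have hPQR : ∀ w, P w = Q w + R w := fun w => by
    simp only [hP, hQ, hR]
    ring
  have hQc : Continuous Q :=
    hGc.mul (((((hrc.sub (hac.pow 2)).sub (hbc.pow 2)).div_const _).sub continuous_const).add
      ((((continuous_const.sub hSc).mul hac).add (hHc.mul hbc)).div_const _))
  have hRc : Continuous R :=
    hGc.mul ((((hac.pow 2).add (hbc.pow 2)).div_const _).sub
      ((((continuous_const.sub hSc).mul hac).add (hHc.mul hbc)).div_const _))
  have hLc : Continuous L :=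
    ((continuous_const.mul (hGc.mul (hHc.pow 2))).sub (continuous_const.mul hGc))
  have hQi : Integrable Q (riemannianMeasure g₁) := integrable_of_continuous (h := g₁) hQc
  have hRi : Integrable R (riemannianMeasure g₁) := integrable_of_continuous (h := g₁) hRc
  have hLi : Integrable L (riemannianMeasure g₁) := integrable_of_continuous (h := g₁) hLc
  have hGi : Integrable G (riemannianMeasure g₁) := integrable_of_continuous (h := g₁) hGc
  have hGHi : Integrable (fun w => G w * Hm w ^ 2) (riemannianMeasure g₁) :=
    integrable_of_continuous (h := g₁) (hGc.mul (hHc.pow 2))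
  -- pointwise lower bound `L ≤ R`
  have hLR : ∀ w, L w ≤ R w := fun w => by
    have hb4 := radialMeanCurvature_bounds (norm_eq_one_of_isUnitNormal hun w)
    exact weighted_square_completion_lowerBound (G w) (a w) (b w) (4 - S w) (Hm w) τ
      (gaussianWeight_comp_nonneg f x₀ w) hτ hb4.1 hb4.2
  -- assemble
  have hPint : ∫ w, P w ∂riemannianMeasure g₁ = ∫ w, R w ∂riemannianMeasure g₁ := by
    rw [show (fun w => P w) = fun w => Q w + R w from funext hPQR, integral_add hQi hRi, hid,
      zero_add]
  have hLint : ∫ w, L w ∂riemannianMeasure g₁ =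
      -(1 / 4) * ∫ w, G w * Hm w ^ 2 ∂riemannianMeasure g₁ - 4 * ∫ w, G w ∂riemannianMeasure g₁ := by
    simp only [hL]
    rw [integral_sub (hGHi.const_mul _) (hGi.const_mul _), integral_const_mul, integral_const_mul]
  calc -(1 / 4) * ∫ w, G w * Hm w ^ 2 ∂riemannianMeasure g₁ - 4 * ∫ w, G w ∂riemannianMeasure g₁
        = ∫ w, L w ∂riemannianMeasure g₁ := hLint.symm
    _ ≤ ∫ w, R w ∂riemannianMeasure g₁ := integral_mono hLi hRi hLR
    _ = ∫ w, P w ∂riemannianMeasure g₁ := hPint.symm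

/-- **The Gaussian weight is bounded by its prefactor**: `G_s(z) ≤ (4πs)⁻²`. [folklore] -/
theorem gaussianWeight_comp_le {M : Type*} (f : M → EuclideanSpace ℝ (Fin 6))
    (x₀ : EuclideanSpace ℝ (Fin 6)) {s : ℝ} (hs : 0 < s) (w : M) :
    Real.exp (-‖f w - x₀‖ ^ 2 / (4 * s)) / (4 * Real.pi * s) ^ 2 ≤ 1 / (4 * Real.pi * s) ^ 2 := by
  have hden : 0 < (4 * Real.pi * s) ^ 2 := by positivity
  refine div_le_div_of_nonneg_right ?_ hden.le
  rw [Real.exp_le_one_iff]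
  have : 0 ≤ ‖f w - x₀‖ ^ 2 / (4 * s) := by positivity
  have h' : -‖f w - x₀‖ ^ 2 / (4 * s) = -(‖f w - x₀‖ ^ 2 / (4 * s)) := by ring
  linarith

/-- **The two-scale static Gaussian monotonicity** for closed immersed cross-sections of
`N = S⁴ × ℝ ⊂ ℝ⁶`: for `0 < σ ≤ τ` and every centre `x₀ ∈ ℝ⁶`,
`e^{4σ} F(σ) ≤ e^{4τ} F(τ) + e^{4τ} (64π²σ)⁻¹ ∫_M H² dμ_g`, `F(s) = ∫_M G_s(f w) dμ_g`.
The function `h(s) = e^{4s} F(s) - e^{4τ} E/(64π² s)` (`E = ∫ H²`) is non-decreasing on `[σ, τ]`: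
`h'(s) = e^{4s}(4F + F') + e^{4τ} E/(64π² s²) ≥ -e^{4s} ∫ G_s H²/4 + e^{4τ} E/(64π² s²) ≥ 0`
by `gaussianDensity_deriv_lowerBound`, `hasDerivAt_integral_gaussianProfile` and `G_s ≤ (4πs)⁻²`.
[cite: ColdingMinicozzi2012, §3] -/
theorem staticTwoScaleMonotonicity {f νf : M → EuclideanSpace ℝ (Fin 6)}
    (hf : (euclideanMetric (EuclideanSpace ℝ (Fin 6))).IsSpacelikeImmersion (𝓡 4) f)
    (hν : ContMDiff (𝓡 4) 𝓘(ℝ, EuclideanSpace ℝ (Fin 6)) ∞ νf)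
    (hun : (euclideanMetric (EuclideanSpace ℝ (Fin 6))).IsUnitNormal (𝓡 4) f νf 1)
    (hN : ∀ x, ∑ i : Fin 5, f x (Fin.castSucc i) ^ 2 = 1)
    (hνN : ∀ x, ∑ i : Fin 5, νf x (Fin.castSucc i) * f x (Fin.castSucc i) = 0)
    (x₀ : EuclideanSpace ℝ (Fin 6)) {σ τ : ℝ} (hσ : 0 < σ) (hστ : σ ≤ τ) :
    Real.exp (4 * σ) * ∫ w, Real.exp (-‖f w - x₀‖ ^ 2 / (4 * σ)) / (4 * Real.pi * σ) ^ 2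
        ∂riemannianMeasure ((euclideanMetric (EuclideanSpace ℝ (Fin 6))).inducedRiemannianMetric f
          contMDiff_pullbackBilin_holds hf) ≤
      Real.exp (4 * τ) * ∫ w, Real.exp (-‖f w - x₀‖ ^ 2 / (4 * τ)) / (4 * Real.pi * τ) ^ 2
        ∂riemannianMeasure ((euclideanMetric (EuclideanSpace ℝ (Fin 6))).inducedRiemannianMetric f
          contMDiff_pullbackBilin_holds hf)
      + Real.exp (4 * τ) / (64 * Real.pi ^ 2 * σ) *
        ∫ w, (euclideanMetric (EuclideanSpace ℝ (Fin 6))).meanCurvature f contMDiff_pullbackBilin_holds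
            hf νf w ^ 2
          ∂riemannianMeasure ((euclideanMetric (EuclideanSpace ℝ (Fin 6))).inducedRiemannianMetric f
            contMDiff_pullbackBilin_holds hf) := by
  set g₁ := (euclideanMetric (EuclideanSpace ℝ (Fin 6))).inducedRiemannianMetric f
    contMDiff_pullbackBilin_holds hf with hg₁
  set Hm : M → ℝ := fun w => (euclideanMetric (EuclideanSpace ℝ (Fin 6))).meanCurvature f
    contMDiff_pullbackBilin_holds hf νf w with hHm
  have hτ : 0 < τ := lt_of_lt_of_le hσ hστ
  -- the density as a function of the scale, and the Willmore energy
  set F : ℝ → ℝ := fun s => ∫ w, Real.exp (-‖f w - x₀‖ ^ 2 / (4 * s)) / (4 * Real.pi * s) ^ 2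
    ∂riemannianMeasure g₁ with hF
  set E : ℝ := ∫ w, Hm w ^ 2 ∂riemannianMeasure g₁ with hE
  have hE0 : 0 ≤ E := integral_nonneg fun w => sq_nonneg _
  have hHc : Continuous Hm := continuous_meanCurvature_euclidean hf hν
  have hH2i : Integrable (fun w => Hm w ^ 2) (riemannianMeasure g₁) :=
    integrable_of_continuous (h := g₁) (hHc.pow 2)
  -- the derivative of `F` and its lower bound, at every scale `s > 0`
  have hFd : ∀ s, 0 < s → HasDerivAt F (∫ w, (Real.exp (-‖f w - x₀‖ ^ 2 / (4 * s)) /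
      (4 * Real.pi * s) ^ 2) * (‖f w - x₀‖ ^ 2 / (4 * s ^ 2) - 2 / s) ∂riemannianMeasure g₁) s :=
    fun s hs => hasDerivAt_integral_gaussianProfile hf x₀ hs
  have hlow : ∀ s, 0 < s → -(E / (64 * Real.pi ^ 2 * s ^ 2)) ≤ 4 * F s +
      ∫ w, (Real.exp (-‖f w - x₀‖ ^ 2 / (4 * s)) / (4 * Real.pi * s) ^ 2) *
        (‖f w - x₀‖ ^ 2 / (4 * s ^ 2) - 2 / s) ∂riemannianMeasure g₁ := by
    intro s hs
    have h1 := gaussianDensity_deriv_lowerBound hf hν hun hN hνN x₀ hs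
    -- `∫ G_s H² ≤ E / (4πs)²`
    have hGc : Continuous fun w => Real.exp (-‖f w - x₀‖ ^ 2 / (4 * s)) / (4 * Real.pi * s) ^ 2 :=
      continuous_gaussianWeight_comp hf x₀ s
    have hGHi : Integrable (fun w => (Real.exp (-‖f w - x₀‖ ^ 2 / (4 * s)) /
        (4 * Real.pi * s) ^ 2) * Hm w ^ 2) (riemannianMeasure g₁) :=
      integrable_of_continuous (h := g₁) (hGc.mul (hHc.pow 2))
    have h2 : ∫ w, (Real.exp (-‖f w - x₀‖ ^ 2 / (4 * s)) / (4 * Real.pi * s) ^ 2) * Hm w ^ 2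
        ∂riemannianMeasure g₁ ≤ ∫ w, (1 / (4 * Real.pi * s) ^ 2) * Hm w ^ 2 ∂riemannianMeasure g₁ :=
      integral_mono hGHi (hH2i.const_mul _) fun w =>
        mul_le_mul_of_nonneg_right (gaussianWeight_comp_le f x₀ hs w) (sq_nonneg _)
    rw [integral_const_mul] at h2
    have h3 : (1 / (4 * Real.pi * s) ^ 2) * E = E / (64 * Real.pi ^ 2 * s ^ 2) * 4 := by
      field_simp
      ring
    have h4 : -(1 / 4) * ∫ w, (Real.exp (-‖f w - x₀‖ ^ 2 / (4 * s)) / (4 * Real.pi * s) ^ 2) *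
        Hm w ^ 2 ∂riemannianMeasure g₁ ≥ -(E / (64 * Real.pi ^ 2 * s ^ 2)) := by
      rw [h3] at h2
      linarith
    simp only [hF]
    linarith
  -- the monotone quantity
  set h : ℝ → ℝ := fun s => Real.exp (4 * s) * F s - Real.exp (4 * τ) * E / (64 * Real.pi ^ 2) * s⁻¹
    with hh
  have hhd : ∀ s, 0 < s → HasDerivAt h (Real.exp (4 * s) * 4 * F s + Real.exp (4 * s) *
      (∫ w, (Real.exp (-‖f w - x₀‖ ^ 2 / (4 * s)) / (4 * Real.pi * s) ^ 2) *
        (‖f w - x₀‖ ^ 2 / (4 * s ^ 2) - 2 / s) ∂riemannianMeasure g₁)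
      - Real.exp (4 * τ) * E / (64 * Real.pi ^ 2) * (-(s ^ 2)⁻¹)) s := by
    intro s hs
    have h4 : HasDerivAt (fun s : ℝ => 4 * s) 4 s := by
      simpa using (hasDerivAt_id s).const_mul (4 : ℝ)
    have he : HasDerivAt (fun s => Real.exp (4 * s)) (Real.exp (4 * s) * 4) s :=
      (Real.hasDerivAt_exp (4 * s)).comp s h4
    have hprod := he.mul (hFd s hs)
    have hinv := (hasDerivAt_inv hs.ne').const_mul (Real.exp (4 * τ) * E / (64 * Real.pi ^ 2))
    exact hprod.sub hinv
  have hhd_nonneg : ∀ s, σ ≤ s → s ≤ τ → 0 ≤ Real.exp (4 * s) * 4 * F s + Real.exp (4 * s) *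
      (∫ w, (Real.exp (-‖f w - x₀‖ ^ 2 / (4 * s)) / (4 * Real.pi * s) ^ 2) *
        (‖f w - x₀‖ ^ 2 / (4 * s ^ 2) - 2 / s) ∂riemannianMeasure g₁)
      - Real.exp (4 * τ) * E / (64 * Real.pi ^ 2) * (-(s ^ 2)⁻¹) := by
    intro s hσs hsτ
    have hs : 0 < s := lt_of_lt_of_le hσ hσs
    have h1 := hlow s hs
    have hexp : Real.exp (4 * s) ≤ Real.exp (4 * τ) := Real.exp_le_exp.2 (by linarith)
    have hexp0 : 0 < Real.exp (4 * s) := Real.exp_pos _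
    have hq : 0 ≤ E / (64 * Real.pi ^ 2 * s ^ 2) := by positivity
    -- `e^{4s} (4F + F') ≥ -e^{4s} E/(64π² s²) ≥ -e^{4τ} E/(64π² s²)`
    have h2 : Real.exp (4 * s) * (4 * F s + ∫ w, (Real.exp (-‖f w - x₀‖ ^ 2 / (4 * s)) /
        (4 * Real.pi * s) ^ 2) * (‖f w - x₀‖ ^ 2 / (4 * s ^ 2) - 2 / s) ∂riemannianMeasure g₁)
        ≥ -(Real.exp (4 * τ) * (E / (64 * Real.pi ^ 2 * s ^ 2))) := by
      have := mul_le_mul_of_nonneg_left h1 hexp0.le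
      nlinarith [mul_le_mul_of_nonneg_right hexp hq]
    have h3 : Real.exp (4 * τ) * E / (64 * Real.pi ^ 2) * (-(s ^ 2)⁻¹)
        = -(Real.exp (4 * τ) * (E / (64 * Real.pi ^ 2 * s ^ 2))) := by
      field_simp
    rw [h3]
    nlinarith
  -- monotonicity on `[σ, τ]`
  have hdiff : ∀ s, 0 < s → DifferentiableAt ℝ h s := fun s hs => (hhd s hs).differentiableAt
  have hcont : ContinuousOn h (Set.Icc σ τ) := fun s hs =>
    (hdiff s (lt_of_lt_of_le hσ hs.1)).continuousAt.continuousWithinAt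
  have hmono : MonotoneOn h (Set.Icc σ τ) := by
    refine monotoneOn_of_deriv_nonneg (convex_Icc σ τ) hcont ?_ ?_
    · intro s hs
      rw [interior_Icc] at hs
      exact (hdiff s (lt_trans hσ hs.1)).differentiableWithinAt
    · intro s hs
      rw [interior_Icc] at hs
      rw [(hhd s (lt_trans hσ hs.1)).deriv]
      exact hhd_nonneg s hs.1.le hs.2.le
  have hστ' := hmono (Set.left_mem_Icc.2 hστ) (Set.right_mem_Icc.2 hστ) hστ
  -- unfold `h σ ≤ h τ`
  simp only [hh] at hστ'
  have hτinv : 0 ≤ Real.exp (4 * τ) * E / (64 * Real.pi ^ 2) * τ⁻¹ := by positivity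
  have hrew : Real.exp (4 * τ) * E / (64 * Real.pi ^ 2) * σ⁻¹ =
      Real.exp (4 * τ) / (64 * Real.pi ^ 2 * σ) * E := by
    field_simp
  simp only [hF, hE] at hστ' hτinv hrew ⊢
  linarith

end Monotonicity

/-! ## The registered helpers -/

/-- **Registered helper `helper_gaussianDensity_deriv_lowerBound` of line `killing-flux` (lead c4,
static monotonicity H4).** `F'(τ) = ∫ G_τ (|r|²/(4τ²) - 2/τ) dμ_g ≥ -¼ ∫ G_τ H² dμ_g - 4 F(τ)` for
closed immersed cross-sections of `N` (`gaussianDensity_deriv_lowerBound`).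
[cite: ColdingMinicozzi2012, §3] -/
theorem helper_gaussianDensity_deriv_lowerBound : ∀ (M : Type) [TopologicalSpace M] [ChartedSpace (EuclideanSpace ℝ (Fin 4)) M] [IsManifold (𝓡 4) ∞ M] [CompactSpace M] [T2Space M] [MeasurableSpace M] [BorelSpace M] (f νf : M → EuclideanSpace ℝ (Fin 6)) (hf : (Literature.Geometry.Riemannian.euclideanMetric (EuclideanSpace ℝ (Fin 6))).IsSpacelikeImmersion (𝓡 4) f), ContMDiff (𝓡 4) (𝓡 6) ∞ νf → (Literature.Geometry.Riemannian.euclideanMetric (EuclideanSpace ℝ (Fin 6))).IsUnitNormal (𝓡 4) f νf 1 → (∀ x, ∑ i : Fin 5, f x (Fin.castSucc i) ^ 2 = 1) → (∀ x, ∑ i : Fin 5, νf x (Fin.castSucc i) * f x (Fin.castSucc i) = 0) → ∀ (x₀ : EuclideanSpace ℝ (Fin 6)) (τ : ℝ), 0 < τ → -(1 / 4) * ∫ w, (Real.exp (-‖f w - x₀‖ ^ 2 / (4 * τ)) / (4 * Real.pi * τ) ^ 2) * (Literature.Geometry.Riemannian.euclideanMetric (EuclideanSpace ℝ (Fin 6))).meanCurvature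 f Literature.Geometry.Lorentzian.PseudoRiemannianMetric.contMDiff_pullbackBilin_holds hf νf w ^ 2 ∂Literature.Geometry.Lorentzian.riemannianMeasure ((Literature.Geometry.Riemannian.euclideanMetric (EuclideanSpace ℝ (Fin 6))).inducedRiemannianMetric f Literature.Geometry.Lorentzian.PseudoRiemannianMetric.contMDiff_pullbackBilin_holds hf) - 4 * ∫ w, Real.exp (-‖f w - x₀‖ ^ 2 / (4 * τ)) / (4 * Real.pi * τ) ^ 2 ∂Literature.Geometry.Lorentzian.riemannianMeasure ((Literature.Geometry.Riemannian.euclideanMetric (EuclideanSpace ℝ (Fin 6))).inducedRiemannianMetric f Literature.Geometry.Lorentzian.PseudoRiemannianMetric.contMDiff_pullbackBilin_holds hf) ≤ ∫ w, (Real.exp (-‖f w - x₀‖ ^ 2 / (4 * τ)) / (4 * Real.pi * τ) ^ 2) * (‖f w - x₀‖ ^ 2 / (4 * τ ^ 2) - 2 / τ) ∂Literature.Geometry.Lorentzian.riemannianMeasure ((Literature.Geometry.Riemannian.euclideanMetric (EuclideanSpace ℝ (Fin 6))).inducedRiemannianMetric f Literature.Geometry.Lorentzian.PseudoRiemannianMetric.contMDiff_pullbackBilin_holds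 hf) :=
  fun _ _ _ _ _ _ _ _ _ _ hf hν hun hN hνN x₀ _ hτ =>
    gaussianDensity_deriv_lowerBound hf hν hun hN hνN x₀ hτ

/-- **Registered helper `helper_staticTwoScaleMonotonicity` of line `killing-flux` (lead c4, static
monotonicity H5).** `e^{4σ} F(σ) ≤ e^{4τ} F(τ) + e^{4τ} (64π²σ)⁻¹ ∫_M H² dμ_g` for `0 < σ ≤ τ`, every
centre `x₀ ∈ ℝ⁶` and every closed immersed cross-section of `N` (`staticTwoScaleMonotonicity`).
[cite: ColdingMinicozzi2012, §3] -/
theorem helper_staticTwoScaleMonotonicity : ∀ (M : Type) [TopologicalSpace M] [ChartedSpace (EuclideanSpace ℝ (Fin 4)) M] [IsManifold (𝓡 4) ∞ M] [CompactSpace M] [T2Space M] [MeasurableSpace M] [BorelSpace M] (f νf : M → EuclideanSpace ℝ (Fin 6)) (hf : (Literature.Geometry.Riemannian.euclideanMetric (EuclideanSpace ℝ (Fin 6))).IsSpacelikeImmersion (𝓡 4) f), ContMDiff (𝓡 4) (𝓡 6) ∞ νf → (Literature.Geometry.Riemannian.euclideanMetric (EuclideanSpace ℝ (Fin 6))).IsUnitNormal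 (𝓡 4) f νf 1 → (∀ x, ∑ i : Fin 5, f x (Fin.castSucc i) ^ 2 = 1) → (∀ x, ∑ i : Fin 5, νf x (Fin.castSucc i) * f x (Fin.castSucc i) = 0) → ∀ (x₀ : EuclideanSpace ℝ (Fin 6)) (σ τ : ℝ), 0 < σ → σ ≤ τ → Real.exp (4 * σ) * ∫ w, Real.exp (-‖f w - x₀‖ ^ 2 / (4 * σ)) / (4 * Real.pi * σ) ^ 2 ∂Literature.Geometry.Lorentzian.riemannianMeasure ((Literature.Geometry.Riemannian.euclideanMetric (EuclideanSpace ℝ (Fin 6))).inducedRiemannianMetric f Literature.Geometry.Lorentzian.PseudoRiemannianMetric.contMDiff_pullbackBilin_holds hf) ≤ Real.exp (4 * τ) * ∫ w, Real.exp (-‖f w - x₀‖ ^ 2 / (4 * τ)) / (4 * Real.pi * τ) ^ 2 ∂Literature.Geometry.Lorentzian.riemannianMeasure ((Literature.Geometry.Riemannian.euclideanMetric (EuclideanSpace ℝ (Fin 6))).inducedRiemannianMetric f Literature.Geometry.Lorentzian.PseudoRiemannianMetric.contMDiff_pullbackBilin_holds hf) + Real.exp (4 * τ) / (64 * Real.pi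 ^ 2 * σ) * ∫ w, (Literature.Geometry.Riemannian.euclideanMetric (EuclideanSpace ℝ (Fin 6))).meanCurvature f Literature.Geometry.Lorentzian.PseudoRiemannianMetric.contMDiff_pullbackBilin_holds hf νf w ^ 2 ∂Literature.Geometry.Lorentzian.riemannianMeasure ((Literature.Geometry.Riemannian.euclideanMetric (EuclideanSpace ℝ (Fin 6))).inducedRiemannianMetric f Literature.Geometry.Lorentzian.PseudoRiemannianMetric.contMDiff_pullbackBilin_holds hf) :=
  fun _ _ _ _ _ _ _ _ _ _ hf hν hun hN hνN x₀ _ _ hσ hστ =>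
    staticTwoScaleMonotonicity hf hν hun hN hνN x₀ hσ hστ

/-- **The uniform local area bound for closed cross-sections of `N`, unconditionally** (lead c4,
H6 ∘ H5): for `0 < ρ ≤ R` and every centre `x₀ ∈ ℝ⁶`,
`μ_g(f⁻¹ B(x₀, ρ)) ≤ e^{4R² + 1/4} (μ_g(M) ρ⁴/R⁴ + ρ²/4 ∫_M H² dμ_g)` — the registered conditional helper
`helper_localAreaBoundOfTwoScale` applied to `helper_staticTwoScaleMonotonicity`. In particular the
area of a cross-section in balls of radius `ρ ≥ (∫H²)^{1/2}` is `≤ C(R, μ_g(M)) ρ⁴` at every centre: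
the "locally uniformly bounded densities" hypothesis of every compactness theorem for the
almost-stationary cross-sections of the line. [cite: Simon1983, §17] -/
theorem helper_localAreaBound : ∀ (M : Type) [TopologicalSpace M] [ChartedSpace (EuclideanSpace ℝ (Fin 4)) M] [IsManifold (𝓡 4) ∞ M] [CompactSpace M] [T2Space M] [MeasurableSpace M] [BorelSpace M] (f νf : M → EuclideanSpace ℝ (Fin 6)) (hf : (Literature.Geometry.Riemannian.euclideanMetric (EuclideanSpace ℝ (Fin 6))).IsSpacelikeImmersion (𝓡 4) f), ContMDiff (𝓡 4) (𝓡 6) ∞ νf → (Literature.Geometry.Riemannian.euclideanMetric (EuclideanSpace ℝ (Fin 6))).IsUnitNormal (𝓡 4) f νf 1 → (∀ x, ∑ i : Fin 5, f x (Fin.castSucc i) ^ 2 = 1) → (∀ x, ∑ i : Fin 5, νf x (Fin.castSucc i) * f x (Fin.castSucc i) = 0) → ∀ (x₀ : EuclideanSpace ℝ (Fin 6)) (ρ R : ℝ), 0 < ρ → ρ ≤ R → (Literature.Geometry.Lorentzian.riemannianMeasure ((Literature.Geometry.Riemannian.euclideanMetric (EuclideanSpace ℝ (Fin 6))).inducedRiemannianMetric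 f Literature.Geometry.Lorentzian.PseudoRiemannianMetric.contMDiff_pullbackBilin_holds hf)).real (f ⁻¹' Metric.ball x₀ ρ) ≤ Real.exp (4 * R ^ 2 + 1 / 4) * ((Literature.Geometry.Lorentzian.riemannianMeasure ((Literature.Geometry.Riemannian.euclideanMetric (EuclideanSpace ℝ (Fin 6))).inducedRiemannianMetric f Literature.Geometry.Lorentzian.PseudoRiemannianMetric.contMDiff_pullbackBilin_holds hf)).real Set.univ * (ρ ^ 4 / R ^ 4) + ρ ^ 2 / 4 * ∫ w, (Literature.Geometry.Riemannian.euclideanMetric (EuclideanSpace ℝ (Fin 6))).meanCurvature f Literature.Geometry.Lorentzian.PseudoRiemannianMetric.contMDiff_pullbackBilin_holds hf νf w ^ 2 ∂Literature.Geometry.Lorentzian.riemannianMeasure ((Literature.Geometry.Riemannian.euclideanMetric (EuclideanSpace ℝ (Fin 6))).inducedRiemannianMetric f Literature.Geometry.Lorentzian.PseudoRiemannianMetric.contMDiff_pullbackBilin_holds hf)) :=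
  helper_localAreaBoundOfTwoScale helper_staticTwoScaleMonotonicity

end Summit.SmoothPoincare4.SmoothPoincare4.Cruxes.CylinderRungTwo.KillingFlux

end
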